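import Literature.NumberTheory.EllipticCurves.AnticyclotomicBigGaloisRep
import Mathlib.NumberTheory.Padics.RingHoms
import HarnessLib

/-!
# Fixed points of a SHIFTED endomorphism on the co-induced module `C^∞(ℤ_p, A)` are finite when `A` is
# finite and the shift is non-zero (the counting core of the finitely decomposed local term, GV00 Prop. 2.4)

Topic `NumberTheory/EllipticCurves`; namespace `Literature.NumberTheory.EllipticCurves.BigRepModule`.
`Proofs`-style file: THEOREMS ONLY (no definition, no named fact, no instance, no `sorry`). Cell `bsd-stepL`,
K2 support 20495 `JSWSigmaLocalCharIdeal`, module L5 (the places FINITELY DECOMPOSED in `K_∞`, Frobenius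
exponent `c = κ(φ_w) ≠ 0`); seat `bsd-stepL-imc-p1` g13.

On the big representation `M = bigRep κ ρ` (co-induced model: smooth `p`-primary functions `Φ : ℤ_p → A`,
`(g·Φ)(x) = ρ(g)(Φ(x − κ g))`, file `AnticyclotomicBigGaloisRep`) an element `g` with `κ g = c ≠ 0` acts by
a SHIFTED endomorphism `Φ ↦ (x ↦ F(Φ(x − c)))`, `F = ρ(g)`. Its fixed points `Φ` satisfy
`Φ(x + c) = F(Φ(x))`, so `Φ(i + m·c) = F^m(Φ(i))`; since `Φ` is locally constant and `i + ℕ·c` is dense in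
`i + p^{v_p(c)}ℤ_p`, **a fixed point is determined by its values on `0, 1, …, p^{v_p(c)} − 1`**
(`eq_of_forall_apply_natCast_eq_of_fixed`). Hence, for FINITE `A`, the fixed points form a finite set
(`finite_setOf_fixed_shift`, `finite_setOf_bigRep_eq_self`), of size `≤ #A^{p^{v_p(c)}}` — whereas for
`c = 0` every constant function is fixed by `F = 1`. This is the elementary mechanism behind "at a prime
finitely decomposed in `K_∞` the local term is controlled by the Euler factor, at a totally split prime by
`μ`" ([GreenbergVatsal2000] Prop. 2.4 vs. [PollackWeston2011] Lemma 3.2; [JetchevSkinnerWan2017] §5.1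
Remark); used for the invariants `H¹(I_w, M)^{D_w/I_w}` and `H¹(D_w/I_w, M^{I_w})` when `E[p^∞]^{I_w}` and
`H¹(I_w, E[p^∞])` are finite (additive reduction).

References: [GreenbergVatsal2000] Prop. 2.4; [SkinnerUrban2014] §3.1.3, Prop. 3.2.3 (the co-induced model);
[Castella2018] §2.1; [PollackWeston2011] Lemma 3.2.
-/

noncomputable section

open scoped Classical

namespace Literature.NumberTheory.EllipticCurves.BigRepModule

variable {𝒪 : Type*} [CommRing 𝒪] {p : ℕ} [Fact p.Prime] {A : Type*} [AddCommGroup A] [Module 𝒪 A]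

/-- Along the shift: a fixed point `Φ` of `Φ ↦ F(Φ(· − c))` satisfies `Φ(x + m·c) = F^m(Φ(x))`.
[cite: SkinnerUrban2014, §3.1.3 and proof of Prop. 3.2.3 (the co-induced model)] -/
theorem apply_add_natCast_mul_of_fixed (F : A →ₗ[𝒪] A) (c : ℤ_[p]) {Φ : BigRepModule 𝒪 p A}
    (hΦ : ∀ x, F (Φ (x - c)) = Φ x) (x : ℤ_[p]) (m : ℕ) :
    Φ (x + m * c) = (F ^ m) (Φ x) := by
  induction m with
  | zero => simp
  | succ m ih =>
    rw [pow_succ', Module.End.mul_apply, ← ih, ← hΦ (x + ((m + 1 : ℕ) : ℤ_[p]) * c)]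
    congr 2
    push_cast
    ring

/-- **A fixed point of the shifted endomorphism is determined by its values on `0, …, p^v − 1`**,
`v = v_p(c)`, `c ≠ 0`: two fixed points `Φ, Ψ` of `Φ ↦ F(Φ(· − c))` agreeing at the natural numbers
`< p^{v_p(c)}` are equal (`i + ℕ·c` is dense in `i + p^v ℤ_p` and `Φ, Ψ` are locally constant).
[cite: GreenbergVatsal2000, Prop. 2.4 (finitely decomposed primes)] [cite: SkinnerUrban2014, §3.1.3] -/
theorem eq_of_forall_apply_natCast_eq_of_fixed (F : A →ₗ[𝒪] A) {c : ℤ_[p]} (hc : c ≠ 0)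
    {Φ Ψ : BigRepModule 𝒪 p A} (hΦ : ∀ x, F (Φ (x - c)) = Φ x) (hΨ : ∀ x, F (Ψ (x - c)) = Ψ x)
    (h : ∀ i : ℕ, i < p ^ c.valuation → Φ i = Ψ i) : Φ = Ψ := by
  obtain ⟨n₁, hn₁⟩ := Φ.exists_level
  obtain ⟨n₂, hn₂⟩ := Ψ.exists_level
  set v := c.valuation with hv
  set u : ℤ_[p]ˣ := PadicInt.unitCoeff hc with hu
  have hcu : c = (u : ℤ_[p]) * (p : ℤ_[p]) ^ v := PadicInt.unitCoeff_spec hc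
  ext y
  -- `y ≡ i (mod p^v)` with `i < p^v`
  set i : ℕ := y.appr v with hi
  have hiy : y - (i : ℤ_[p]) ∈ Ideal.span {(p : ℤ_[p]) ^ v} := PadicInt.appr_spec v y
  obtain ⟨t, ht⟩ := Ideal.mem_span_singleton'.mp hiy
  -- `y ≡ i + m c (mod p^(n₁+n₂))` for `m = appr (t u⁻¹) (n₁ + n₂)`
  set N := n₁ + n₂ with hN
  set m : ℕ := (t * (u⁻¹ : ℤ_[p]ˣ)).appr N with hm
  have hm' : t * ((u⁻¹ : ℤ_[p]ˣ) : ℤ_[p]) - (m : ℤ_[p]) ∈ Ideal.span {(p : ℤ_[p]) ^ N} :=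
    PadicInt.appr_spec N _
  obtain ⟨s, hs⟩ := Ideal.mem_span_singleton'.mp hm'
  have hkey : y - ((i : ℤ_[p]) + (m : ℤ_[p]) * c) ∈ Ideal.span {(p : ℤ_[p]) ^ N} := by
    refine Ideal.mem_span_singleton'.mpr ⟨s * (u : ℤ_[p]) * (p : ℤ_[p]) ^ v, ?_⟩
    have e1 : y - ((i : ℤ_[p]) + (m : ℤ_[p]) * c) = (y - i) - (m : ℤ_[p]) * c := by ring
    rw [e1, ← ht, hcu]
    have e2 : (m : ℤ_[p]) = t * ((u⁻¹ : ℤ_[p]ˣ) : ℤ_[p]) - s * (p : ℤ_[p]) ^ N := by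
      linear_combination hs
    rw [e2]
    have e3 : ((u⁻¹ : ℤ_[p]ˣ) : ℤ_[p]) * (u : ℤ_[p]) = 1 := by
      rw [← Units.val_mul, inv_mul_cancel, Units.val_one]
    linear_combination (t * (p : ℤ_[p]) ^ v) * e3
  have h1 : Φ y = Φ ((i : ℤ_[p]) + (m : ℤ_[p]) * c) :=
    hn₁ _ _ (Ideal.span_singleton_le_span_singleton.mpr (pow_dvd_pow _ (Nat.le_add_right n₁ n₂)) hkey)
  have h2 : Ψ y = Ψ ((i : ℤ_[p]) + (m : ℤ_[p]) * c) :=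
    hn₂ _ _ (Ideal.span_singleton_le_span_singleton.mpr (pow_dvd_pow _ (Nat.le_add_left n₂ n₁)) hkey)
  rw [h1, h2, apply_add_natCast_mul_of_fixed F c hΦ, apply_add_natCast_mul_of_fixed F c hΨ,
    h i (PadicInt.appr_lt y v)]

/-- **Finiteness of the fixed points of the shifted endomorphism** `Φ ↦ F(Φ(· − c))` on `C^∞(ℤ_p, A)`
for FINITE `A` and `c ≠ 0`: they inject into the finite set of functions `{0, …, p^{v_p(c)} − 1} → A`.
[cite: GreenbergVatsal2000, Prop. 2.4 (finitely decomposed primes)] -/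
theorem finite_setOf_fixed_shift [Finite A] (F : A →ₗ[𝒪] A) {c : ℤ_[p]} (hc : c ≠ 0) :
    Set.Finite {Φ : BigRepModule 𝒪 p A | ∀ x, F (Φ (x - c)) = Φ x} := by
  let key : {Φ : BigRepModule 𝒪 p A | ∀ x, F (Φ (x - c)) = Φ x} → (Fin (p ^ c.valuation) → A) :=
    fun Φ i => (Φ : BigRepModule 𝒪 p A) (i : ℕ)
  haveI : Finite {Φ : BigRepModule 𝒪 p A | ∀ x, F (Φ (x - c)) = Φ x} := by
    refine Finite.of_injective key fun Φ Ψ hΦΨ => Subtype.ext ?_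
    refine eq_of_forall_apply_natCast_eq_of_fixed F hc Φ.2 Ψ.2 fun i hi => ?_
    exact congrFun hΦΨ ⟨i, hi⟩
  exact Set.toFinite _

section Rep

open Literature.NumberTheory.GaloisRepresentations

variable {G : Type*} [Group G] [TopologicalSpace G] [ContinuousMul G] [TopologicalSpace 𝒪]
  [TopologicalSpace A] [DiscreteTopology A] [TopologicalSpace (PowerSeries 𝒪)]

/-- **Finitely many fixed points of a group element of non-zero exponent on the big representation**:
for `M = bigRep κ ρ` on a FINITE discrete `A` and `g` with `κ g ≠ 0` (a Frobenius at a place finitely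
decomposed in `K_∞`), the set `{Φ ∈ M | g·Φ = Φ}` is finite (`(g·Φ)(x) = ρ(g)(Φ(x − κ g))`).
[cite: GreenbergVatsal2000, Prop. 2.4] [cite: Castella2018, §2.1 (G_K-action ρ ⊗ Ψ⁻¹ on 𝒜)] -/
theorem finite_setOf_bigRep_eq_self [Finite A] (κ : G →ₜ* Multiplicative ℤ_[p]) (ρ : ContinuousRep G 𝒪 A)
    {g : G} (hg : (κ g).toAdd ≠ 0) :
    Set.Finite {Φ : BigRepModule 𝒪 p A | bigRep κ ρ g Φ = Φ} := by
  refine (finite_setOf_fixed_shift (p := p) (ρ g) hg).subset fun Φ hΦ x => ?_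
  have h := congrArg (fun Ψ : BigRepModule 𝒪 p A => Ψ x) hΦ
  simpa only [bigRep_apply_apply] using h

end Rep

end Literature.NumberTheory.EllipticCurves.BigRepModule

end
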